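import Literature.NumberTheory.Transcendental.RoySmallValueBasic
import Literature.RingTheory.KrullDimension.AffineCatenary
import Literature.RingTheory.MvPolynomial.HomogeneousDimension
import Mathlib.RingTheory.KrullDimension.Polynomial
import Mathlib.RingTheory.Ideal.MinimalPrime.Noetherian
import Mathlib.RingTheory.Ideal.Height
import Mathlib.RingTheory.Ideal.KrullsHeightTheorem
import Mathlib.RingTheory.Polynomial.UniqueFactorization
import HarnessLib

/-!
# Roy's small value estimate for `𝔾ₐ × 𝔾ₘ` — two coprime ternary forms have finitely many common zeros

Topic `Literature/NumberTheory/Transcendental`. Part of the formalisation of the proof of Roy 2013,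
Theorem 1.1 (named fact `roy2013_thm_1_1`, `RoySmallValueEstimates.lean`), seat B. In the proof
of Proposition 6.4 of D. Roy, *A small value estimate for `𝔾ₐ × 𝔾ₘ`*, Mathematika 59 (2013)
333–363 = arXiv:1301.0663 (p. 17 of the arXiv text) one reads: "`Q = ∑ aᵢ 𝒟ⁱP` is relatively
prime to `P`. Then `𝒵(P, Q)` has dimension `0`". This file proves that statement in the concrete
form used downstream (finitely many common zeros in `ℙ²(ℂ)`, and hence a line avoiding them):

* `aeval_lineMap_of_isHomogeneous` — along the line `t ↦ t·α` a form `P` of degree `n` becomes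
  `P(α) tⁿ`; the kernel `𝔭_α` of `ℂ[X₀,X₁,X₂] → ℂ[t]`, `Xᵢ ↦ αᵢ t` (the homogeneous ideal of the
  point `(α₀:α₁:α₂)`) is a prime containing exactly the forms vanishing at `α`, with
  `dim ℂ[X]/𝔭_α = 1`, hence of height `2` (dimension formula for affine domains,
  `Literature.RingTheory.KrullDimension.ringKrullDim_quotient_add_height`);
* `eq_lineKer_of_mem_minimalPrimes` — for coprime forms `P, Q`, every minimal prime of `(P, Q)`
  below `𝔭_α` equals `𝔭_α` (it contains `(π, Q)` for a prime factor `π ∤ Q` of `P`, whose minimal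
  primes have `dim = 1` by Krull's principal ideal theorem,
  `Literature.RingTheory.MvPolynomial.ringKrullDim_quotient_add_one_of_mem_minimalPrimes_sup_span`);
* `finite_common_zeros` — **the common zeros of two coprime forms in `ℙ²(ℂ)` are finite**: they
  inject into the finite set of minimal primes of `(P, Q)`;
* `exists_lineForm_ne_zero` — consequently some line `X₀ + c X₁ + c² X₂ = 0`, `c ∈ ℕ`, contains no
  common zero of `P` and `Q`.

Everything is proved; no definitions, no named facts.

## References

* [Roy2013] D. Roy, *A small value estimate for 𝔾ₐ × 𝔾ₘ*, Mathematika 59 (2013), 333–363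
  (arXiv:1301.0663), §6, proof of Prop. 6.4 ("`𝒵(P,Q)` has dimension `0`").
* [Matsumura1987] H. Matsumura, *Commutative Ring Theory*, Thm 5.6, Thm 13.5.
-/

noncomputable section

open MvPolynomial

namespace Literature.NumberTheory.Transcendental

namespace Roy2013

/-! ### The line through a point and its ideal -/

/-- Along the line `t ↦ t·α`, a form of degree `n` becomes `P(α) tⁿ`. [folklore] -/
theorem aeval_lineMap_of_isHomogeneous (α : Fin 3 → ℂ) {P : CX} {n : ℕ}
    (hP : P.IsHomogeneous n) :
    aeval (fun i => Polynomial.C (α i) * Polynomial.X) P =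
      Polynomial.C (aeval α P) * Polynomial.X ^ n := by
  classical
  have key : ∀ m ∈ P.support,
      aeval (fun i => Polynomial.C (α i) * Polynomial.X) (monomial m (coeff m P)) =
        Polynomial.C (aeval α (monomial m (coeff m P))) * Polynomial.X ^ n := by
    intro m hm
    rw [aeval_monomial, aeval_monomial, Finsupp.prod, Finsupp.prod, Polynomial.algebraMap_eq,
      Algebra.algebraMap_self_apply]
    simp_rw [mul_pow, Finset.prod_mul_distrib, Finset.prod_pow_eq_pow_sum,
      ← hP.degree_eq_sum_deg_support hm, ← map_pow, ← map_prod, ← mul_assoc, ← map_mul]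
  conv_lhs => rw [P.as_sum, map_sum]
  rw [Finset.sum_congr rfl key, ← Finset.sum_mul, ← map_sum, ← map_sum, ← P.as_sum]

/-- The kernel `𝔭_α` of `Xᵢ ↦ αᵢ t` is a prime ideal. [folklore] -/
theorem isPrime_lineKer (α : Fin 3 → ℂ) :
    (RingHom.ker (aeval (R := ℂ) fun i => Polynomial.C (α i) * Polynomial.X :
      CX →ₐ[ℂ] Polynomial ℂ)).IsPrime :=
  RingHom.ker_isPrime _

/-- A form lies in `𝔭_α` iff it vanishes at `α`. [folklore] -/
theorem mem_lineKer_iff_of_isHomogeneous (α : Fin 3 → ℂ) {P : CX} {n : ℕ}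
    (hP : P.IsHomogeneous n) :
    P ∈ RingHom.ker (aeval (R := ℂ) fun i => Polynomial.C (α i) * Polynomial.X :
      CX →ₐ[ℂ] Polynomial ℂ) ↔ aeval α P = 0 := by
  rw [RingHom.mem_ker]
  change aeval (fun i => Polynomial.C (α i) * Polynomial.X) P = 0 ↔ _
  rw [aeval_lineMap_of_isHomogeneous α hP, mul_eq_zero, Polynomial.C_eq_zero, or_iff_left]
  exact pow_ne_zero _ Polynomial.X_ne_zero

/-- For `α ≠ 0` the map `Xᵢ ↦ αᵢ t` is onto `ℂ[t]`. [folklore] -/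
theorem lineMap_surjective {α : Fin 3 → ℂ} (hα : α ≠ 0) :
    Function.Surjective (aeval (R := ℂ) fun i => Polynomial.C (α i) * Polynomial.X :
      CX →ₐ[ℂ] Polynomial ℂ) := by
  obtain ⟨i, hi⟩ := Function.ne_iff.mp hα
  intro f
  refine ⟨Polynomial.aeval (C (α i)⁻¹ * X i : CX) f, ?_⟩
  rw [← AlgHom.comp_apply, ← Polynomial.aeval_algHom]
  have hX : (aeval (R := ℂ) fun i => Polynomial.C (α i) * Polynomial.X : CX →ₐ[ℂ] Polynomial ℂ)
      (C (α i)⁻¹ * X i) = Polynomial.X := by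
    rw [map_mul, aeval_C, aeval_X, Polynomial.algebraMap_eq, ← mul_assoc, ← map_mul,
      inv_mul_cancel₀ hi, map_one, one_mul]
  rw [hX]
  exact Polynomial.aeval_X_left_apply f

/-- `dim ℂ[X₀,X₁,X₂]/𝔭_α = 1` for `α ≠ 0`. [folklore] -/
theorem ringKrullDim_quotient_lineKer {α : Fin 3 → ℂ} (hα : α ≠ 0) :
    ringKrullDim (CX ⧸ RingHom.ker (aeval (R := ℂ) fun i => Polynomial.C (α i) * Polynomial.X :
      CX →ₐ[ℂ] Polynomial ℂ)) = 1 := by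
  rw [ringKrullDim_eq_of_ringEquiv
      (Ideal.quotientKerAlgEquivOfSurjective (lineMap_surjective hα)).toRingEquiv,
    Polynomial.ringKrullDim_of_isNoetherianRing, ringKrullDim_eq_zero_of_field ℂ, zero_add]

/-- `height 𝔭_α = 2` for `α ≠ 0` (dimension formula `dim ℂ[X]/𝔭 + height 𝔭 = 3`).
[cite: Matsumura1987, Thm 5.6] -/
theorem height_lineKer {α : Fin 3 → ℂ} (hα : α ≠ 0) :
    (RingHom.ker (aeval (R := ℂ) fun i => Polynomial.C (α i) * Polynomial.X :
      CX →ₐ[ℂ] Polynomial ℂ)).height = 2 := by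
  haveI := isPrime_lineKer α
  have h := Literature.RingTheory.KrullDimension.ringKrullDim_quotient_add_height ℂ
    (RingHom.ker (aeval (R := ℂ) fun i => Polynomial.C (α i) * Polynomial.X :
      CX →ₐ[ℂ] Polynomial ℂ))
  rw [ringKrullDim_quotient_lineKer hα, MvPolynomial.ringKrullDim_of_isNoetherianRing,
    ringKrullDim_eq_zero_of_field ℂ, zero_add, Nat.card_eq_fintype_card, Fintype.card_fin] at h
  -- `h : 1 + height = 3` in `WithBot ℕ∞`
  have hfin : (RingHom.ker (aeval (R := ℂ) fun i => Polynomial.C (α i) * Polynomial.X :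
      CX →ₐ[ℂ] Polynomial ℂ)).height ≠ ⊤ := by
    intro htop
    rw [htop] at h
    exact absurd h (by decide)
  obtain ⟨m, hm⟩ := ENat.ne_top_iff_exists.mp hfin
  rw [← hm] at h ⊢
  have h' : (((1 + m : ℕ) : ℕ∞) : WithBot ℕ∞) = (((3 : ℕ) : ℕ∞) : WithBot ℕ∞) := by
    push_cast; exact h
  have h'' : 1 + m = 3 := ENat.coe_inj.mp (WithBot.coe_eq_coe.mp h')
  have : m = 2 := by omega
  subst this; rfl

/-- Two non-zero points with the same ideal `𝔭_α = 𝔭_β` are proportional. [folklore] -/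
theorem exists_smul_of_lineKer_le {α β : Fin 3 → ℂ} (hβ : β ≠ 0)
    (h : RingHom.ker (aeval (R := ℂ) fun i => Polynomial.C (β i) * Polynomial.X :
        CX →ₐ[ℂ] Polynomial ℂ) ≤
      RingHom.ker (aeval (R := ℂ) fun i => Polynomial.C (α i) * Polynomial.X :
        CX →ₐ[ℂ] Polynomial ℂ)) :
    ∃ c : ℂ, α = c • β := by
  obtain ⟨j, hj⟩ := Function.ne_iff.mp hβ
  rw [Pi.zero_apply] at hj
  refine ⟨α j / β j, funext fun i => ?_⟩
  -- the linear form `β_j X_i − β_i X_j` vanishes at `β`, hence at `α`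
  set L : CX := C (β j) * X i - C (β i) * X j with hL
  have hLh : L.IsHomogeneous 1 :=
    ((isHomogeneous_C _ _).mul (isHomogeneous_X ℂ i)).sub
      ((isHomogeneous_C _ _).mul (isHomogeneous_X ℂ j))
  have hLβ : L ∈ RingHom.ker (aeval (R := ℂ) fun i => Polynomial.C (β i) * Polynomial.X :
      CX →ₐ[ℂ] Polynomial ℂ) := by
    rw [mem_lineKer_iff_of_isHomogeneous β hLh, hL]
    simp only [map_sub, map_mul, aeval_C, aeval_X, Algebra.algebraMap_self_apply]
    ring
  have hLα := (mem_lineKer_iff_of_isHomogeneous α hLh).mp (h hLβ)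
  rw [hL] at hLα
  simp only [map_sub, map_mul, aeval_C, aeval_X, Algebra.algebraMap_self_apply] at hLα
  rw [Pi.smul_apply, smul_eq_mul]
  field_simp
  linear_combination hLα

/-! ### Minimal primes of `(P, Q)` -/

/-- A prime ideal containing a non-zero non-unit `P` contains a prime factor of `P`. [folklore] -/
theorem exists_prime_dvd_mem {𝔓 : Ideal CX} (h𝔓 : 𝔓.IsPrime) {P : CX} (hP0 : P ≠ 0)
    (hP : P ∈ 𝔓) : ∃ π : CX, Prime π ∧ π ∣ P ∧ π ∈ 𝔓 := by
  classical
  have hprod : (UniqueFactorizationMonoid.factors P).prod ∈ 𝔓 := by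
    obtain ⟨u, hu⟩ := UniqueFactorizationMonoid.factors_prod hP0
    rw [← hu] at hP
    exact (h𝔓.mem_or_mem (by simpa using hP)).resolve_right fun h =>
      h𝔓.ne_top (Ideal.eq_top_of_isUnit_mem _ h u.isUnit)
  obtain ⟨π, hπ, hπ𝔓⟩ := (h𝔓.multiset_prod_mem_iff_exists_mem _).mp hprod
  exact ⟨π, UniqueFactorizationMonoid.prime_of_factor π hπ,
    UniqueFactorizationMonoid.dvd_of_mem_factors hπ, hπ𝔓⟩

/-- **Minimal primes of `(P, Q)` for coprime forms.** If `P, Q ∈ ℂ[X₀,X₁,X₂]` are relatively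
prime, `P ≠ 0`, then a minimal prime `𝔓` of `(P, Q)` contained in the ideal
`𝔭_α` of a point `α ≠ 0` equals `𝔭_α` (Krull: `𝔓 ⊇ (π, Q)` for a prime factor `π ∤ Q` of `P`,
so `𝔓` has height `≥ 2 = height 𝔭_α`). [cite: Roy2013, proof of Prop. 6.4 ("𝒵(P,Q) has dimension 0")] -/
theorem eq_lineKer_of_mem_minimalPrimes {P Q : CX} (hPQ : IsRelPrime P Q) (hP0 : P ≠ 0)
    {α : Fin 3 → ℂ} (hα : α ≠ 0) {𝔓 : Ideal CX}
    (h𝔓 : 𝔓 ∈ (Ideal.span {P, Q}).minimalPrimes)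
    (hle : 𝔓 ≤ RingHom.ker (aeval (R := ℂ) fun i => Polynomial.C (α i) * Polynomial.X :
      CX →ₐ[ℂ] Polynomial ℂ)) :
    𝔓 = RingHom.ker (aeval (R := ℂ) fun i => Polynomial.C (α i) * Polynomial.X :
      CX →ₐ[ℂ] Polynomial ℂ) := by
  haveI h𝔓p : 𝔓.IsPrime := h𝔓.1.1
  haveI := isPrime_lineKer α
  have hPQle : Ideal.span {P, Q} ≤ 𝔓 := h𝔓.1.2
  have hP𝔓 : P ∈ 𝔓 := hPQle (Ideal.subset_span (by simp))
  have hQ𝔓 : Q ∈ 𝔓 := hPQle (Ideal.subset_span (by simp))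
  -- a prime factor `π` of `P` in `𝔓`, not dividing `Q`
  obtain ⟨π, hπ, hπP, hπ𝔓⟩ := exists_prime_dvd_mem h𝔓p hP0 hP𝔓
  have hπQ : Q ∉ Ideal.span {π} := fun h => by
    have hdvd : π ∣ Q := Ideal.mem_span_singleton.mp h
    exact hπ.not_unit (hPQ hπP hdvd)
  haveI hπprime : (Ideal.span {π} : Ideal CX).IsPrime := (Ideal.span_singleton_prime hπ.ne_zero).mpr hπ
  -- a minimal prime `𝔔` of `(π) + (Q)` inside `𝔓`
  have hle' : Ideal.span {π} ⊔ Ideal.span {Q} ≤ 𝔓 :=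
    sup_le ((Ideal.span_singleton_le_iff_mem _).mpr hπ𝔓) ((Ideal.span_singleton_le_iff_mem _).mpr hQ𝔓)
  obtain ⟨𝔔, h𝔔, h𝔔le⟩ := Ideal.exists_minimalPrimes_le hle'
  haveI h𝔔p : 𝔔.IsPrime := h𝔔.1.1
  -- `dim ℂ[X]/𝔔 = 1`
  have hdimπ : ringKrullDim (CX ⧸ Ideal.span {π}) = 2 := by
    have := Literature.RingTheory.KrullDimension.ringKrullDim_quotient_span_of_prime_mvPolynomial
      (F := ℂ) hπ
    simpa using this
  have hdim𝔔 : ringKrullDim (CX ⧸ 𝔔) = 1 := by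
    have h1 := Literature.RingTheory.MvPolynomial.ringKrullDim_quotient_add_one_of_mem_minimalPrimes_sup_span
      hπQ h𝔔
    rw [hdimπ] at h1
    -- `h1 : dim + 1 = 2`
    have hne : ringKrullDim (CX ⧸ 𝔔) ≠ ⊥ := by
      intro hb; rw [hb] at h1; exact absurd h1 (by decide)
    have hne' : ringKrullDim (CX ⧸ 𝔔) ≠ ⊤ := by
      intro ht; rw [ht] at h1; exact absurd h1 (by decide)
    obtain ⟨d, hd⟩ : ∃ d : ℕ, ringKrullDim (CX ⧸ 𝔔) = d := by
      revert hne hne' h1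
      generalize ringKrullDim (CX ⧸ 𝔔) = q
      intro h1 hne hne'
      induction q using WithBot.recBotCoe with
      | bot => exact absurd rfl hne
      | coe q =>
        induction q using ENat.recTopCoe with
        | top => exact absurd rfl hne'
        | coe d => exact ⟨d, rfl⟩
    rw [hd] at h1 ⊢
    have h2 : (((d + 1 : ℕ) : ℕ∞) : WithBot ℕ∞) = (((2 : ℕ) : ℕ∞) : WithBot ℕ∞) := by
      push_cast; exact h1
    have h3 : d + 1 = 2 := ENat.coe_inj.mp (WithBot.coe_eq_coe.mp h2)
    have : d = 1 := by omega
    subst this; rfl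
  -- hence `height 𝔔 = 2`
  have hht𝔔 : 𝔔.height = 2 := by
    have h := Literature.RingTheory.KrullDimension.ringKrullDim_quotient_add_height ℂ 𝔔
    rw [hdim𝔔, MvPolynomial.ringKrullDim_of_isNoetherianRing, ringKrullDim_eq_zero_of_field ℂ,
      zero_add, Nat.card_eq_fintype_card, Fintype.card_fin] at h
    have hfin : 𝔔.height ≠ ⊤ := by
      intro htop; rw [htop] at h; exact absurd h (by decide)
    obtain ⟨m, hm⟩ := ENat.ne_top_iff_exists.mp hfin
    rw [← hm] at h ⊢
    have h' : (((1 + m : ℕ) : ℕ∞) : WithBot ℕ∞) = (((3 : ℕ) : ℕ∞) : WithBot ℕ∞) := by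
      push_cast; exact h
    have h'' : 1 + m = 3 := ENat.coe_inj.mp (WithBot.coe_eq_coe.mp h')
    have : m = 2 := by omega
    subst this; rfl
  -- `2 = height 𝔔 ≤ height 𝔓` and `𝔓 ≤ 𝔭_α` of height `2`: equality
  have h2le : (2 : ℕ∞) ≤ 𝔓.height := hht𝔔 ▸ Ideal.height_mono h𝔔le
  refine Ideal.eq_of_le_of_height_le 𝔓 hle ?_
  rw [height_lineKer hα]
  exact h2le

/-! ### Finiteness of the common zeros -/

/-- **Two coprime forms of `ℂ[X₀, X₁, X₂]` have finitely many common zeros in `ℙ²(ℂ)`**: there is a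
finite set `S` of non-zero vectors such that every non-zero common zero of `P` and `Q` is a
multiple of an element of `S`. [cite: Roy2013, proof of Prop. 6.4 ("𝒵(P,Q) has dimension 0")] -/
theorem finite_common_zeros {P Q : CX} {D E : ℕ} (hP : P.IsHomogeneous D) (hQ : Q.IsHomogeneous E)
    (hPQ : IsRelPrime P Q) :
    ∃ S : Finset (Fin 3 → ℂ), (∀ s ∈ S, s ≠ 0) ∧ ∀ α : Fin 3 → ℂ, α ≠ 0 → aeval α P = 0 →
      aeval α Q = 0 → ∃ s ∈ S, ∃ c : ℂ, α = c • s := by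
  classical
  -- degenerate cases: `P = 0` (then `Q` is a unit) or `P` a unit — no common zeros at all
  by_cases hP0 : P = 0
  · refine ⟨∅, by simp, fun α _ _ hQα => ?_⟩
    exfalso
    have hQu : IsUnit Q := hPQ (hP0 ▸ dvd_zero Q) dvd_rfl
    exact (hQu.map (aeval α)).ne_zero hQα
  by_cases hPu : IsUnit P
  · refine ⟨∅, by simp, fun α _ hPα _ => ?_⟩
    exfalso
    exact (hPu.map (aeval α)).ne_zero hPα
  -- the finitely many minimal primes of `(P, Q)`
  set I : Ideal CX := Ideal.span {P, Q} with hI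
  have hfin : I.minimalPrimes.Finite := Ideal.finite_minimalPrimes_of_isNoetherianRing CX I
  -- for each minimal prime, a point whose ideal it is, if any
  let φ : Ideal CX → Fin 3 → ℂ := fun 𝔮 =>
    if h : ∃ β : Fin 3 → ℂ, β ≠ 0 ∧ 𝔮 = RingHom.ker (aeval (R := ℂ) fun i =>
        Polynomial.C (β i) * Polynomial.X : CX →ₐ[ℂ] Polynomial ℂ) then h.choose else 0
  refine ⟨(hfin.toFinset.image φ).filter (· ≠ 0), fun s hs => (Finset.mem_filter.mp hs).2,
    fun α hα hPα hQα => ?_⟩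
  set 𝔭 : Ideal CX := RingHom.ker (aeval (R := ℂ) fun i => Polynomial.C (α i) * Polynomial.X :
    CX →ₐ[ℂ] Polynomial ℂ) with h𝔭
  haveI := isPrime_lineKer α
  have hI𝔭 : I ≤ 𝔭 := by
    rw [hI, Ideal.span_le]
    intro f hf
    rcases hf with rfl | hf
    · exact (mem_lineKer_iff_of_isHomogeneous α hP).mpr hPα
    · rw [Set.mem_singleton_iff] at hf
      rw [hf]
      exact (mem_lineKer_iff_of_isHomogeneous α hQ).mpr hQα
  obtain ⟨𝔓, h𝔓, h𝔓le⟩ := Ideal.exists_minimalPrimes_le hI𝔭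
  have h𝔓eq : 𝔓 = 𝔭 := eq_lineKer_of_mem_minimalPrimes hPQ hP0 hα h𝔓 h𝔓le
  -- the chosen point for `𝔭`
  have hex : ∃ β : Fin 3 → ℂ, β ≠ 0 ∧ 𝔭 = RingHom.ker (aeval (R := ℂ) fun i =>
      Polynomial.C (β i) * Polynomial.X : CX →ₐ[ℂ] Polynomial ℂ) := ⟨α, hα, rfl⟩
  have hφ : φ 𝔭 = hex.choose := dif_pos hex
  have hβ0 : hex.choose ≠ 0 := hex.choose_spec.1
  have hβeq := hex.choose_spec.2
  obtain ⟨c, hc⟩ := exists_smul_of_lineKer_le hβ0 hβeq.symm.le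
  refine ⟨φ 𝔭, Finset.mem_filter.mpr ⟨Finset.mem_image.mpr ⟨𝔭, ?_, rfl⟩, hφ ▸ hβ0⟩, c, hφ ▸ hc⟩
  rw [Set.Finite.mem_toFinset, ← h𝔓eq]
  exact h𝔓

/-- **A line avoiding the common zeros.** For coprime forms `P, Q` there is `c ∈ ℕ` such that no
common zero `α ≠ 0` of `P, Q` lies on the line `X₀ + c X₁ + c² X₂ = 0`.
[cite: Roy2013, proof of Prop. 6.4 (finiteness of `𝒵(P,Q)`), used for the choice of the frame] -/
theorem exists_lineForm_ne_zero {P Q : CX} {D E : ℕ} (hP : P.IsHomogeneous D)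
    (hQ : Q.IsHomogeneous E) (hPQ : IsRelPrime P Q) :
    ∃ c : ℕ, ∀ α : Fin 3 → ℂ, α ≠ 0 → aeval α P = 0 → aeval α Q = 0 →
      α 0 + c * α 1 + (c : ℂ) ^ 2 * α 2 ≠ 0 := by
  classical
  obtain ⟨S, hS0, hS⟩ := finite_common_zeros hP hQ hPQ
  -- for each `s ∈ S` the polynomial `s₀ + s₁ c + s₂ c²` in `c` is non-zero, so has ≤ 2 roots
  let bad : (Fin 3 → ℂ) → Finset ℕ := fun s =>
    (Finset.range (2 * S.card + 1)).filter fun c => s 0 + c * s 1 + (c : ℂ) ^ 2 * s 2 = 0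
  have hbad : ∀ s ∈ S, (bad s).card ≤ 2 := by
    intro s hs
    -- the roots in `ℕ` of a non-zero polynomial of degree ≤ 2
    set p : Polynomial ℂ := Polynomial.C (s 0) + Polynomial.C (s 1) * Polynomial.X +
      Polynomial.C (s 2) * Polynomial.X ^ 2 with hp
    have hp0 : p ≠ 0 := by
      intro h0
      apply hS0 s hs
      have h0' : ∀ k, p.coeff k = 0 := fun k => by rw [h0, Polynomial.coeff_zero]
      have e0 := h0' 0; have e1 := h0' 1; have e2 := h0' 2
      simp only [hp, Polynomial.coeff_add, Polynomial.coeff_C, Polynomial.coeff_C_mul,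
        Polynomial.coeff_X, Polynomial.coeff_X_pow] at e0 e1 e2
      norm_num at e0 e1 e2
      funext i; fin_cases i <;> simp [e0, e1, e2]
    have hdeg : p.natDegree ≤ 2 := by
      rw [hp]
      refine (Polynomial.natDegree_add_le _ _).trans (max_le ((Polynomial.natDegree_add_le _ _).trans
        (max_le (by simp) ?_)) ?_)
      · exact (Polynomial.natDegree_C_mul_le _ _).trans (by simp)
      · exact (Polynomial.natDegree_C_mul_le _ _).trans (by simp)
    have hroots : ∀ c ∈ bad s, (c : ℂ) ∈ p.roots := by
      intro c hc
      rw [Polynomial.mem_roots hp0, Polynomial.IsRoot.def, hp]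
      simp only [Polynomial.eval_add, Polynomial.eval_C, Polynomial.eval_mul, Polynomial.eval_X,
        Polynomial.eval_pow]
      have := (Finset.mem_filter.mp hc).2
      linear_combination this
    calc (bad s).card = ((bad s).image (fun c : ℕ => (c : ℂ))).card :=
          (Finset.card_image_of_injective _ Nat.cast_injective).symm
      _ ≤ p.roots.toFinset.card := Finset.card_le_card fun x hx => by
          obtain ⟨c, hc, rfl⟩ := Finset.mem_image.mp hx
          exact Multiset.mem_toFinset.mpr (hroots c hc)
      _ ≤ Multiset.card p.roots := Multiset.toFinset_card_le _
      _ ≤ p.natDegree := Polynomial.card_roots' p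
      _ ≤ 2 := hdeg
  -- a good `c` among `0, …, 2|S|`
  have hcard : (S.biUnion bad).card < (Finset.range (2 * S.card + 1)).card := by
    calc (S.biUnion bad).card ≤ ∑ s ∈ S, (bad s).card := Finset.card_biUnion_le
      _ ≤ ∑ _s ∈ S, 2 := Finset.sum_le_sum hbad
      _ = 2 * S.card := by rw [Finset.sum_const, smul_eq_mul, mul_comm]
      _ < 2 * S.card + 1 := Nat.lt_succ_self _
      _ = _ := (Finset.card_range _).symm
  obtain ⟨c, hc, hcbad⟩ := Finset.exists_mem_notMem_of_card_lt_card hcard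
  refine ⟨c, fun α hα hPα hQα h0 => ?_⟩
  obtain ⟨s, hs, k, rfl⟩ := hS α hα hPα hQα
  have hk : k ≠ 0 := by rintro rfl; exact hα (zero_smul _ _)
  apply hcbad
  refine Finset.mem_biUnion.mpr ⟨s, hs, Finset.mem_filter.mpr ⟨hc, ?_⟩⟩
  simp only [Pi.smul_apply, smul_eq_mul] at h0
  have : k * (s 0 + c * s 1 + (c : ℂ) ^ 2 * s 2) = 0 := by linear_combination h0
  exact (mul_eq_zero.mp this).resolve_left hk

end Roy2013

end Literature.NumberTheory.Transcendental
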